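import Summits.CriticalPhenomena.Ising3DConformalLimit.Theses.FKParityRobustness
import Summits.CriticalPhenomena.Ising3DConformalLimit.Theses.EnergyNotSigmaSquared
import Summits.CriticalPhenomena.Ising3DConformalLimit.Theorems.FKParityRobustnessIndependentStrandsJoinLimitDictionary
import Summits.CriticalPhenomena.Ising3DConformalLimit.Theorems.FKParityRobustnessFarMergingGivesU4
import Summits.CriticalPhenomena.Ising3DConformalLimit.Theorems.FKParityRobustnessJoinForcesU4
import HarnessLib

/-!
# The crux `IndependentStrandsJoin` is clause (iii) plus the tetrahedral shape transfer
# (line `pinch-to-tetra`, reshape r4; registered sub-goal `stub_nonGaussianResidual`)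

(crux item stmt-CriticalPhenomena-14625, route `FKParityRobustness`, sub-problem `Ising3DConformalLimit`; lead
`prover-line-stmt-CriticalPhenomena-14625-c4-0`, 2026-08-17; `--supports stmt-CriticalPhenomena-14625`.)

Pure glue over landed theorems; no new definition.  Write `y_A` for the regular tetrahedron cast to `ℝ³` (`yTetra`),
`U₄(S) = limitConnectedFour S`, and (spelled out inline below, never abbreviated)

  `TNV`  : for every non-degenerate pointwise scaling limit `(ρ, S)` of `criticalCorr 3`, `HasNontrivialU4 S → U₄(S)(y_A) < 0`;
  `TNVᴹ` : the same for MÖBIUS-COVARIANT limits `(ρ, Δ, S)` only (weaker).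

`NonGaussianLimit` is the shared item stmt-CriticalPhenomena-0636 verbatim (clause (iii) of the sub-problem for every
non-degenerate pointwise limit; in this route the rank-9 support implied by the crux through the CLOSED bridge
`JoinForcesU4`, item stmt-CriticalPhenomena-14627).

Results (axioms `propext`, `Classical.choice`, `Quot.sound`):
* `nonGaussianLimit_of_independentStrandsJoin` — crux `→ NonGaussianLimit` (= `joinForcesU4_proof`, by `Iff.rfl`);
* `nonGaussianLimit_of_gap_gffm` — `EnergyGapPowerLaw → GapForcesFarMerging → NonGaussianLimit` (the two cruxes of route
  `EnergyNotSigmaSquared`, items stmt-CriticalPhenomena-4469/4468, give clause (iii) for every limit: landed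
  `farMergingGivesU4_proof`); so revision r4 of the line (inputs `MoebiusLimit`, `NonGaussianLimit`, `TNVᴹ`) is implied by
  revision r3 (inputs `MoebiusLimit`, `EnergyGapPowerLaw`, `GapForcesFarMerging`, `TNVᴹ`, landed `stub_continuumResidual`);
* `independentStrandsJoin_of_limit_nonGaussian_tnv`, `independentStrandsJoin_of_moebius_nonGaussian_tnvM` (= registered
  sub-goal `Theorems.stub_nonGaussianResidual`) — the r4 composition: `LimitExists → NonGaussianLimit → TNV → crux`,
  `MoebiusLimit → NonGaussianLimit → TNVᴹ → crux`;
* `independentStrandsJoin_iff_nonGaussian_and_tnv`, `independentStrandsJoin_iff_nonGaussian_and_tnvM` — the EXACT residual: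
  under `LimitExists` (resp. `MoebiusLimit` = item stmt-CriticalPhenomena-1344, a binder of the route's deciding theorem)
  `IndependentStrandsJoin ↔ NonGaussianLimit ∧ TNV` (resp. `∧ TNVᴹ`).  Modulo the route's own imported complement the
  rank-2 crux IS "clause (iii) AND tetrahedral non-vanishing of the continuum Ursell function" — no more, no less;
* `ising3DConformalLimit_of_moebius_nonGaussian` — calibration at summit level: `MoebiusLimit → NonGaussianLimit →
  Ising3DConformalLimit` with no use of the crux (the sub-problem is the 6-tuple), i.e. of the crux's two conjuncts only
  clause (iii) is consumed by the summit; `TNVᴹ` is what the crux asserts BEYOND the sub-problem's clause (iii).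
References: M. Aizenman, Comm. Math. Phys. 86 (1982) [AizenmanCMP1982]; M. Aizenman, H. Duminil-Copin, Ann. of Math. 194
(2021), eq. (3.11) [AizenmanDuminilCopinAnnals2021]; S. Rychkov, D. Simmons-Duffin, B. Zan, JHEP 2017, arXiv:1612.02436
[RychkovSimmonsDuffinZan2017] (the tetrahedral point `u = v = 1` is `Q_min = 0.683` of the bootstrap four-point function).
-/

noncomputable section

open Filter Topology Finset
open Literature.Probability.LatticeModels
open Summit.CriticalPhenomena.Ising3DConformalLimit.Theses.FKParityRobustness
open Summit.CriticalPhenomena.Ising3DConformalLimit.Theses.EnergyNotSigmaSquared (EnergyGapPowerLaw GapForcesFarMerging)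
open Summit.CriticalPhenomena.Ising3DConformalLimit.FKParityRobustnessFarMergingGivesU4 (farMergingGivesU4_proof)
open Summit.CriticalPhenomena.Ising3DConformalLimit.FKParityRobustnessJoinForcesU4 (joinForcesU4_proof)
open Summit.CriticalPhenomena.Ising3DConformalLimit.Cruxes.ParityRobustMerging.PlaquetteXorSurgery (tetra)

namespace Summit.CriticalPhenomena.Ising3DConformalLimit.Cruxes.IndependentStrandsJoin.PinchToTetra

/-! ## Clause (iii) from the crux, and from the `EnergyNotSigmaSquared` cruxes -/

/-- **Crux ⟹ `NonGaussianLimit`** (item stmt-CriticalPhenomena-0636): the closed bridge `JoinForcesU4`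
(`joinForcesU4_proof`, item stmt-CriticalPhenomena-14627), whose statement is `IndependentStrandsJoin → NonGaussianLimit`
by `Iff.rfl`. [cite: AizenmanCMP1982, Prop. 5.3] -/
theorem nonGaussianLimit_of_independentStrandsJoin : IndependentStrandsJoin → NonGaussianLimit :=
  joinForcesU4_proof

/-- **`EnergyGapPowerLaw → GapForcesFarMerging → NonGaussianLimit`**: far merging along infinitely many dilations of SOME
injective lattice shape (the consequent of `GapForcesFarMerging`, item stmt-CriticalPhenomena-4468, fed with its antecedent
`EnergyGapPowerLaw`, item stmt-CriticalPhenomena-4469) gives `U₄(S) ≢ 0` for every non-degenerate pointwise limit (landed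
`farMergingGivesU4_proof`, item stmt-CriticalPhenomena-4471). [cite: AizenmanDuminilCopinAnnals2021, eq. (3.11)] -/
theorem nonGaussianLimit_of_gap_gffm (hgap : EnergyGapPowerLaw) (hgffm : GapForcesFarMerging) : NonGaussianLimit :=
  farMergingGivesU4_proof (hgffm hgap)

/-! ## The r4 composition -/

/-- **`LimitExists → NonGaussianLimit → TNV → IndependentStrandsJoin`.**  The posited limit has `U₄(S) ≢ 0` by clause (iii);
`TNV` localises it at the regular tetrahedron; the landed dictionary (`independentStrandsJoin_iff_limitU4_tetra_neg`, ←: limit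
upgrade + per-scale crux) returns the lattice crux. [folklore] -/
theorem independentStrandsJoin_of_limit_nonGaussian_tnv (hL : LimitExists) (hNG : NonGaussianLimit)
    (htnv : ∀ (ρ : ℝ → ℝ) (S : CorrFamily 3), (∀ δ ∈ Set.Ioc (0:ℝ) 1, 0 < ρ δ) →
      HasPointwiseScalingLimit (criticalCorr 3) ρ S → IsNondegenerateTwoPoint S → HasNontrivialU4 S →
      limitConnectedFour S yTetra < 0) :
    IndependentStrandsJoin := by
  obtain ⟨ρ, S, hρ, hlim, hnd⟩ := hL
  exact (independentStrandsJoin_iff_limitU4_tetra_neg hρ hlim hnd).2 (htnv ρ S hρ hlim hnd (hNG ρ S hρ hlim hnd))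

/-- **`MoebiusLimit → NonGaussianLimit → TNVᴹ → IndependentStrandsJoin`** (`MoebiusLimit` = item stmt-CriticalPhenomena-1344
verbatim, `NonGaussianLimit` = item stmt-CriticalPhenomena-0636 verbatim, residual in its weakest form). [folklore] -/
theorem independentStrandsJoin_of_moebius_nonGaussian_tnvM (hM : MoebiusLimit) (hNG : NonGaussianLimit)
    (htnvM : ∀ (ρ : ℝ → ℝ) (Δ : ℝ) (S : CorrFamily 3), (∀ δ ∈ Set.Ioc (0:ℝ) 1, 0 < ρ δ) →
      HasPointwiseScalingLimit (criticalCorr 3) ρ S → IsNondegenerateTwoPoint S → IsMoebiusCovariant Δ S →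
      HasNontrivialU4 S → limitConnectedFour S yTetra < 0) :
    IndependentStrandsJoin := by
  obtain ⟨ρ, Δ, S, hρ, -, hlim, hnd, hmob⟩ := hM
  exact (independentStrandsJoin_iff_limitU4_tetra_neg hρ hlim hnd).2
    (htnvM ρ Δ S hρ hlim hnd hmob (hNG ρ S hρ hlim hnd))

/-! ## The exact residual: crux ↔ clause (iii) ∧ tetrahedral non-vanishing -/

/-- **Under `LimitExists`: `IndependentStrandsJoin ↔ NonGaussianLimit ∧ TNV`.**  (→: the closed bridge and the landed
`tnv_of_independentStrandsJoin`; ←: `independentStrandsJoin_of_limit_nonGaussian_tnv`.) [folklore] -/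
theorem independentStrandsJoin_iff_nonGaussian_and_tnv (hL : LimitExists) :
    IndependentStrandsJoin ↔ (NonGaussianLimit ∧
      ∀ (ρ : ℝ → ℝ) (S : CorrFamily 3), (∀ δ ∈ Set.Ioc (0:ℝ) 1, 0 < ρ δ) →
        HasPointwiseScalingLimit (criticalCorr 3) ρ S → IsNondegenerateTwoPoint S → HasNontrivialU4 S →
        limitConnectedFour S yTetra < 0) :=
  ⟨fun h => ⟨nonGaussianLimit_of_independentStrandsJoin h,
      fun _ _ hρ hlim hnd _ => (independentStrandsJoin_iff_limitU4_tetra_neg hρ hlim hnd).1 h⟩,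
    fun h => independentStrandsJoin_of_limit_nonGaussian_tnv hL h.1 h.2⟩

/-- **Under `MoebiusLimit` (item stmt-CriticalPhenomena-1344): `IndependentStrandsJoin ↔ NonGaussianLimit ∧ TNVᴹ`.**  Modulo the
route's own imported complement, the rank-2 crux is EXACTLY clause (iii) [shared item stmt-CriticalPhenomena-0636] AND the
tetrahedral shape transfer for Möbius-covariant limits. [folklore] -/
theorem independentStrandsJoin_iff_nonGaussian_and_tnvM (hM : MoebiusLimit) :
    IndependentStrandsJoin ↔ (NonGaussianLimit ∧
      ∀ (ρ : ℝ → ℝ) (Δ : ℝ) (S : CorrFamily 3), (∀ δ ∈ Set.Ioc (0:ℝ) 1, 0 < ρ δ) →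
        HasPointwiseScalingLimit (criticalCorr 3) ρ S → IsNondegenerateTwoPoint S → IsMoebiusCovariant Δ S →
        HasNontrivialU4 S → limitConnectedFour S yTetra < 0) :=
  ⟨fun h => ⟨nonGaussianLimit_of_independentStrandsJoin h,
      fun _ _ _ hρ hlim hnd _ _ => (independentStrandsJoin_iff_limitU4_tetra_neg hρ hlim hnd).1 h⟩,
    fun h => independentStrandsJoin_of_moebius_nonGaussian_tnvM hM h.1 h.2⟩

/-! ## Calibration at summit level -/

/-- **`MoebiusLimit → NonGaussianLimit → Ising3DConformalLimit`, without the crux.**  The sub-problem is the 6-tuple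
(limit, `Δ > 0`, non-degeneracy, Möbius covariance, `U₄ ≢ 0`); of the crux's two conjuncts
(`independentStrandsJoin_iff_nonGaussian_and_tnvM`) only clause (iii) is consumed by it — tetrahedral non-vanishing is what
the crux asserts beyond the sub-problem's clause (iii). [folklore] -/
theorem ising3DConformalLimit_of_moebius_nonGaussian (hM : MoebiusLimit) (hNG : NonGaussianLimit) :
    _root_.Ising3DConformalLimit := by
  obtain ⟨ρ, Δ, S, hρ, hΔ, hlim, hnd, hmob⟩ := hM
  exact ⟨ρ, Δ, S, hρ, hΔ, hlim, hnd, hmob, hNG ρ S hρ hlim hnd⟩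

end Summit.CriticalPhenomena.Ising3DConformalLimit.Cruxes.IndependentStrandsJoin.PinchToTetra

/-! ## The registered sub-goal `stub_nonGaussianResidual` -/

namespace Summit.CriticalPhenomena.Ising3DConformalLimit.Theorems

open Summit.CriticalPhenomena.Ising3DConformalLimit.Cruxes.IndependentStrandsJoin.PinchToTetra
open Summit.CriticalPhenomena.Ising3DConformalLimit.Cruxes.ParityRobustMerging.PlaquetteXorSurgery (tetra)

/-- **Registered sub-goal `stub_nonGaussianResidual` of the crux `IndependentStrandsJoin`** (stmt-CriticalPhenomena-14625,
line `pinch-to-tetra` r4): the crux follows from the route's own item `MoebiusLimit` (stmt-CriticalPhenomena-1344), the shared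
item `NonGaussianLimit` (stmt-CriticalPhenomena-0636) verbatim, and tetrahedral non-vanishing of the continuum Ursell function
for Möbius-covariant limits. -/
theorem stub_nonGaussianResidual :
    MoebiusLimit → NonGaussianLimit →
      (∀ (ρ : ℝ → ℝ) (Δ : ℝ) (S : CorrFamily 3), (∀ δ ∈ Set.Ioc (0:ℝ) 1, 0 < ρ δ) →
        HasPointwiseScalingLimit (criticalCorr 3) ρ S → IsNondegenerateTwoPoint S → IsMoebiusCovariant Δ S →
        HasNontrivialU4 S → limitConnectedFour S (fun i => WithLp.toLp 2 fun k => ((tetra i k : ℤ) : ℝ)) < 0) →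
      IndependentStrandsJoin :=
  fun hM hNG htnvM => independentStrandsJoin_of_moebius_nonGaussian_tnvM hM hNG htnvM

end Summit.CriticalPhenomena.Ising3DConformalLimit.Theorems

end
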